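import Literature.IUT.HodgeTheaters.GoodLocalFrobenioidOfGaloisCor411
import Literature.IUT.HodgeTheaters.ConventionsCatIsomorphismGroup
import HarnessLib

/-!
# [IUTchI] Corollary 5.3 (ii) at good nonarchimedean `v`: the natural map `Isom(C¹_v, C²_v) → Isom(𝒟¹_v, 𝒟²_v)`
# is REAL — `CatIsomorphism.HasUnder` / `UnderUnique` DISCHARGED for the structure functors `C_v → 𝓑(Π_v)⁰`

S. Mochizuki, *Inter-universal Teichmüller theory I*, kurims manuscript (May 2020), §0 p. 33 ("isomorphism of
categories" = isomorphism class of equivalences) and Corollary 5.3 (ii) p. 144 l. 14–18 ("the natural map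
`Isom(¹𝔉, ²𝔉) → Isom(¹𝔇, ²𝔇)` is bijective") ([IUTchI] Cor 5.3 p.144) [claim: Mochizuki2012, status: disputed] —
nothing of the series is asserted; no side is taken on [IUTchIII] Cor. 3.12.  The mathematics is [FrdI] Cor. 4.11 (ii)
[cite: MochizukiFrdI2008, Cor. 4.11 p.91] at the [FrdII] Ex. 1.1 / Ex. 1.3 (i) Frobenioids
[cite: MochizukiFrdII2008, Ex 1.3 (i) p.11].

PROOF-ONLY companion (cell abc-iut; seat abc-iut-w4-d109; L5 hub H2 row T3 «COR411-ON-EQUIV-AT-REAL-CV», v2 = the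
NAMED binders) of `GoodLocalFrobenioidOfGaloisCor411.lean`: there the existence and essential uniqueness of the
equivalence of bases lying under an equivalence `Ψ : C¹_v ⥲ C²_v` were stated UNFOLDED (abc-iut-L5-t4's §0 file
`ConventionsCatIsomorphismGroup.lean` had no olean yet); here they are read as abc-iut-L5-t4's displayed binders
`CatIsomorphism.HasUnder p₁ p₂` / `CatIsomorphism.UnderUnique p₁ p₂` (by unfolding, `Iff.rfl`-level), so that the
natural map `CatIsomorphism.descend he hu : Isom(C¹_v, C²_v) → Isom(𝒟¹_v, 𝒟²_v)` of Cor. 5.3 (ii) is DEFINED WITHOUT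
BINDERS at: (§1) any `p`-adic Frobenioid data over slim REAL coset bases `𝓑(Πᵢ)⁰ = CosetCat Πᵢ`; (§2) abc-iut-L5-t2's
REAL instances `GoodLocalFrobenioid.ofGalois` (structure functors `toBase : C_v → 𝓑(Π_v)⁰`), modulo only the
slimness of `Π¹_v, Π²_v`; (§3) with NO hypothesis at `ofPadicGalois pᵢ` and at actual places with `Π_v := G_v`.

HONEST LIMITS.  `HasUnder`/`UnderUnique` make the natural map exist; its BIJECTIVITY (`DescendBijective`) is Cor. 5.3
(ii)'s content proper ([AbsTopIII] Prop 3.2 (iv) — rows N1–N3 — and the pair-lifting schema F-0409) and is NOT claimed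
here.  Typed ≠ proved elsewhere; nothing here bears on [IUTchIII] Cor. 3.12.
-/

noncomputable section

-- `GoodLocalFrobenioid.ofGalois` fields / `ModelFrobenioid.data` unfold only at default transparency.
set_option backward.isDefEq.respectTransparency false

namespace Literature.IUT.HodgeTheaters

open CategoryTheory Literature.AnabelianGeometry.SemiGraphs Literature.AlgebraicGeometry.Frobenioids
open Literature.AlgebraicGeometry.Frobenioids.PadicFrd

universe u

namespace GoodLocalFrobenioid

/-! ### §1. Over the REAL coset bases `𝓑(Π)⁰ = CosetCat Π` -/

section CosetData

variable {P₁ : Type u} [Group P₁] [TopologicalSpace P₁] [IsTopologicalGroup P₁]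
  {P₂ : Type u} [Group P₂] [TopologicalSpace P₂] [IsTopologicalGroup P₂]
  {p₁ p₂ : ℕ} [Fact p₁.Prime] [Fact p₂.Prime]
  (Q₁ : Datum (CosetCat P₁) p₁) (Q₂ : Datum (CosetCat P₂) p₂)

/-- **`HasUnder Base₁ Base₂` DISCHARGED** for `p`-adic Frobenioids over slim REAL coset bases: under every
`Ψ : C₁ ⥲ C₂` lies an equivalence `𝓑(Π₁)⁰ ⥲ 𝓑(Π₂)⁰` ([FrdI] Cor. 4.11 (ii)). ([IUTchI] Cor 5.3 p.144) [claim: Mochizuki2012, status: disputed] -/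
theorem hasUnder_base_cosetCat (hsl₁ : IsSlim (CosetCat P₁)) (hsl₂ : IsSlim (CosetCat P₂)) :
    CatIsomorphism.HasUnder (ModelFrobenioid.data Q₁.Φ Q₁.B Q₁.divB).base (ModelFrobenioid.data Q₂.Φ Q₂.B Q₂.divB).base :=
  fun Ψ => exists_equivalence_under_base_cosetCat Q₁ Q₂ hsl₁ hsl₂ Ψ

/-- **`UnderUnique Base₁ Base₂` DISCHARGED** for `p`-adic Frobenioids over slim REAL coset bases: the equivalence of
bases under `Ψ` is unique up to isomorphism ([FrdI] Cor. 4.11 (ii), `1`-uniqueness). ([IUTchI] Cor 5.3 p.144) [claim: Mochizuki2012, status: disputed] -/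
theorem underUnique_base_cosetCat (hsl₁ : IsSlim (CosetCat P₁)) (hsl₂ : IsSlim (CosetCat P₂)) :
    CatIsomorphism.UnderUnique (ModelFrobenioid.data Q₁.Φ Q₁.B Q₁.divB).base
      (ModelFrobenioid.data Q₂.Φ Q₂.B Q₂.divB).base :=
  fun Ψ Θ Θ' h h' => nonempty_iso_of_under_base_cosetCat Q₁ Q₂ hsl₁ hsl₂ Ψ Θ Θ' h h'

/-- Hence **the natural map `Isom(C₁, C₂) → Isom(𝓑(Π₁)⁰, 𝓑(Π₂)⁰)` sends the class of `Ψ` to the class of ANY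
equivalence lying under `Ψ`** (abc-iut-L5-t4's `descend_mk`, now binder-free over slim coset bases).
([IUTchI] Cor 5.3 p.144) [claim: Mochizuki2012, status: disputed] -/
theorem descend_mk_base_cosetCat (hsl₁ : IsSlim (CosetCat P₁)) (hsl₂ : IsSlim (CosetCat P₂))
    {Ψ : Q₁.frobenioid ≌ Q₂.frobenioid} {Θ : CosetCat P₁ ≌ CosetCat P₂}
    (h : Nonempty (CatIsomorphism.LiesUnder (ModelFrobenioid.data Q₁.Φ Q₁.B Q₁.divB).base
      (ModelFrobenioid.data Q₂.Φ Q₂.B Q₂.divB).base Ψ Θ)) :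
    CatIsomorphism.descend (hasUnder_base_cosetCat Q₁ Q₂ hsl₁ hsl₂) (underUnique_base_cosetCat Q₁ Q₂ hsl₁ hsl₂)
        (CatIsomorphism.mk Ψ) = CatIsomorphism.mk Θ :=
  CatIsomorphism.descend_mk _ _ h

/-- Group form: for slim PROFINITE `Π₁, Π₂` ("[AbsAnab] Lem. 1.3.1"), `HasUnder` and `UnderUnique` hold over the coset
bases. ([IUTchI] Cor 5.3 p.144) [claim: Mochizuki2012, status: disputed] -/
theorem hasUnder_and_underUnique_base_cosetCat_of_isSlimGroup [CompactSpace P₁] [TotallyDisconnectedSpace P₁]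
    [CompactSpace P₂] [TotallyDisconnectedSpace P₂] (hZ₁ : IsSlimGroup P₁) (hZ₂ : IsSlimGroup P₂) :
    CatIsomorphism.HasUnder (ModelFrobenioid.data Q₁.Φ Q₁.B Q₁.divB).base
        (ModelFrobenioid.data Q₂.Φ Q₂.B Q₂.divB).base ∧
      CatIsomorphism.UnderUnique (ModelFrobenioid.data Q₁.Φ Q₁.B Q₁.divB).base
        (ModelFrobenioid.data Q₂.Φ Q₂.B Q₂.divB).base :=
  ⟨hasUnder_base_cosetCat Q₁ Q₂ (isSlim_cosetCat_of_isSlimGroup hZ₁) (isSlim_cosetCat_of_isSlimGroup hZ₂),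
    underUnique_base_cosetCat Q₁ Q₂ (isSlim_cosetCat_of_isSlimGroup hZ₁) (isSlim_cosetCat_of_isSlimGroup hZ₂)⟩

end CosetData

/-! ### §2. At `GoodLocalFrobenioid.ofGalois`: the structure functors `toBase : C_v → 𝓑(Π_v)⁰` -/

section OfGalois

variable {p₁ : ℕ} [Fact p₁.Prime] (d₁ : GaloisValDatum.{u} p₁) {P₁ : Type u} [Group P₁] [TopologicalSpace P₁]
  (aug₁ : P₁ →* d₁.Gal) (hc₁ : Continuous aug₁) (hs₁ : Function.Surjective aug₁) (ho₁ : IsOpenMap aug₁)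
  (Kv₁ : Type) [Field Kv₁] [ValuativeRel Kv₁] (hp₁ : ((p₁ : Kv₁)) ∈ PadicFrd.intNonzero Kv₁)
variable {p₂ : ℕ} [Fact p₂.Prime] (d₂ : GaloisValDatum.{u} p₂) {P₂ : Type u} [Group P₂] [TopologicalSpace P₂]
  (aug₂ : P₂ →* d₂.Gal) (hc₂ : Continuous aug₂) (hs₂ : Function.Surjective aug₂) (ho₂ : IsOpenMap aug₂)
  (Kv₂ : Type) [Field Kv₂] [ValuativeRel Kv₂] (hp₂ : ((p₂ : Kv₂)) ∈ PadicFrd.intNonzero Kv₂)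

/-- **`HasUnder toBase₁ toBase₂` at two REAL instances `ofGalois`**, slim coset bases.
([IUTchI] Cor 5.3 p.144) [claim: Mochizuki2012, status: disputed] -/
theorem hasUnder_toBase_ofGalois [IsTopologicalGroup P₁] [IsTopologicalGroup P₂]
    (hsl₁ : IsSlim (CosetCat P₁)) (hsl₂ : IsSlim (CosetCat P₂)) :
    CatIsomorphism.HasUnder (ofGalois d₁ aug₁ hc₁ hs₁ ho₁ Kv₁ hp₁).toBase (ofGalois d₂ aug₂ hc₂ hs₂ ho₂ Kv₂ hp₂).toBase :=
  fun Ψ => exists_equivalence_under_toBase_ofGalois d₁ aug₁ hc₁ hs₁ ho₁ Kv₁ hp₁ d₂ aug₂ hc₂ hs₂ ho₂ Kv₂ hp₂ hsl₁ hsl₂ Ψ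

/-- **`UnderUnique toBase₁ toBase₂` at two REAL instances `ofGalois`**, slim coset bases.
([IUTchI] Cor 5.3 p.144) [claim: Mochizuki2012, status: disputed] -/
theorem underUnique_toBase_ofGalois [IsTopologicalGroup P₁] [IsTopologicalGroup P₂]
    (hsl₁ : IsSlim (CosetCat P₁)) (hsl₂ : IsSlim (CosetCat P₂)) :
    CatIsomorphism.UnderUnique (ofGalois d₁ aug₁ hc₁ hs₁ ho₁ Kv₁ hp₁).toBase
      (ofGalois d₂ aug₂ hc₂ hs₂ ho₂ Kv₂ hp₂).toBase :=
  fun Ψ Θ Θ' h h' =>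
    nonempty_iso_of_under_toBase_ofGalois d₁ aug₁ hc₁ hs₁ ho₁ Kv₁ hp₁ d₂ aug₂ hc₂ hs₂ ho₂ Kv₂ hp₂ hsl₁ hsl₂ Ψ Θ Θ' h h'

/-- **Group form at `ofGalois`** ("[AbsAnab] Lem. 1.3.1": `Πⁱ_v` slim profinite): `HasUnder ∧ UnderUnique` for the
structure functors `toBase`, so `CatIsomorphism.descend` — the natural map `Isom(C¹_v, C²_v) → Isom(𝒟¹_v, 𝒟²_v)` of
Cor. 5.3 (ii) — is defined without binders. ([IUTchI] Cor 5.3 p.144) [claim: Mochizuki2012, status: disputed] -/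
theorem hasUnder_and_underUnique_toBase_ofGalois_of_isSlimGroup [IsTopologicalGroup P₁] [CompactSpace P₁]
    [TotallyDisconnectedSpace P₁] [IsTopologicalGroup P₂] [CompactSpace P₂] [TotallyDisconnectedSpace P₂]
    (hZ₁ : IsSlimGroup P₁) (hZ₂ : IsSlimGroup P₂) :
    CatIsomorphism.HasUnder (ofGalois d₁ aug₁ hc₁ hs₁ ho₁ Kv₁ hp₁).toBase
        (ofGalois d₂ aug₂ hc₂ hs₂ ho₂ Kv₂ hp₂).toBase ∧
      CatIsomorphism.UnderUnique (ofGalois d₁ aug₁ hc₁ hs₁ ho₁ Kv₁ hp₁).toBase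
        (ofGalois d₂ aug₂ hc₂ hs₂ ho₂ Kv₂ hp₂).toBase :=
  ⟨hasUnder_toBase_ofGalois d₁ aug₁ hc₁ hs₁ ho₁ Kv₁ hp₁ d₂ aug₂ hc₂ hs₂ ho₂ Kv₂ hp₂
      (isSlim_cosetCat_of_isSlimGroup hZ₁) (isSlim_cosetCat_of_isSlimGroup hZ₂),
    underUnique_toBase_ofGalois d₁ aug₁ hc₁ hs₁ ho₁ Kv₁ hp₁ d₂ aug₂ hc₂ hs₂ ho₂ Kv₂ hp₂
      (isSlim_cosetCat_of_isSlimGroup hZ₁) (isSlim_cosetCat_of_isSlimGroup hZ₂)⟩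

end OfGalois

/-! ### §3. Hypothesis-free at the genuine witnesses -/

section OfPadicGalois

variable (p₁ p₂ : ℕ) [Fact p₁.Prime] [Fact p₂.Prime]

/-- **NO hypothesis at `ofPadicGalois pᵢ`** (`K_v = ℚ_{pᵢ}`, `Π_v := G_{ℚ_{pᵢ}}`, slim by [pGC] Lem. 15.8):
`HasUnder ∧ UnderUnique` for `toBase`. ([IUTchI] Cor 5.3 p.144) [claim: Mochizuki2012, status: disputed] -/
theorem hasUnder_and_underUnique_toBase_ofPadicGalois :
    CatIsomorphism.HasUnder (ofPadicGalois p₁).toBase (ofPadicGalois p₂).toBase ∧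
      CatIsomorphism.UnderUnique (ofPadicGalois p₁).toBase (ofPadicGalois p₂).toBase :=
  ⟨fun Ψ => exists_equivalence_under_base_cosetCat _ _ (isSlim_cosetCat_galQp p₁) (isSlim_cosetCat_galQp p₂) Ψ,
    fun Ψ Θ Θ' h h' =>
      nonempty_iso_of_under_base_cosetCat _ _ (isSlim_cosetCat_galQp p₁) (isSlim_cosetCat_galQp p₂) Ψ Θ Θ' h h'⟩

end OfPadicGalois

section OfPlace

open Literature.NumberTheory.NumberFields IsDedekindDomain NumberField

variable (F₁ : Type) [Field F₁] [NumberField F₁] (p₁ : ℕ) [Fact p₁.Prime] (v₁ : HeightOneSpectrum (𝓞 F₁))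
  (hv₁ : ((p₁ : ℕ) : 𝓞 F₁) ∈ v₁.asIdeal) (Kv₁ : Type) [Field Kv₁] [ValuativeRel Kv₁]
  (hp₁ : ((p₁ : Kv₁)) ∈ PadicFrd.intNonzero Kv₁)
variable (F₂ : Type) [Field F₂] [NumberField F₂] (p₂ : ℕ) [Fact p₂.Prime] (v₂ : HeightOneSpectrum (𝓞 F₂))
  (hv₂ : ((p₂ : ℕ) : 𝓞 F₂) ∈ v₂.asIdeal) (Kv₂ : Type) [Field Kv₂] [ValuativeRel Kv₂]
  (hp₂ : ((p₂ : Kv₂)) ∈ PadicFrd.intNonzero Kv₂)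

/-- **NO hypothesis at two ACTUAL places with `Π_v := G_v`** (`K_v := (Fᵢ)_{vᵢ}`, `Ω := F̄ᵢ,vᵢ`; `G_v` slim by
[AbsAnab] Thm. 1.1.1 (ii), `galoisMLF_slim_holds`): `HasUnder ∧ UnderUnique` for `toBase`.
([IUTchI] Cor 5.3 p.144) [claim: Mochizuki2012, status: disputed] -/
theorem hasUnder_and_underUnique_toBase_ofGalois_ofPlace_self :
    CatIsomorphism.HasUnder
        (ofGalois (GaloisValDatum.ofPlace F₁ p₁ v₁ hv₁) (MonoidHom.id _) continuous_id Function.surjective_id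
          IsOpenMap.id Kv₁ hp₁).toBase
        (ofGalois (GaloisValDatum.ofPlace F₂ p₂ v₂ hv₂) (MonoidHom.id _) continuous_id Function.surjective_id
          IsOpenMap.id Kv₂ hp₂).toBase ∧
      CatIsomorphism.UnderUnique
        (ofGalois (GaloisValDatum.ofPlace F₁ p₁ v₁ hv₁) (MonoidHom.id _) continuous_id Function.surjective_id
          IsOpenMap.id Kv₁ hp₁).toBase
        (ofGalois (GaloisValDatum.ofPlace F₂ p₂ v₂ hv₂) (MonoidHom.id _) continuous_id Function.surjective_id
          IsOpenMap.id Kv₂ hp₂).toBase :=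
  ⟨fun Ψ => exists_equivalence_under_base_cosetCat _ _
      (isSlim_cosetCat_of_isSlimGroup (isSlimGroup_gal_ofPlace F₁ p₁ v₁ hv₁))
      (isSlim_cosetCat_of_isSlimGroup (isSlimGroup_gal_ofPlace F₂ p₂ v₂ hv₂)) Ψ,
    fun Ψ Θ Θ' h h' => nonempty_iso_of_under_base_cosetCat _ _
      (isSlim_cosetCat_of_isSlimGroup (isSlimGroup_gal_ofPlace F₁ p₁ v₁ hv₁))
      (isSlim_cosetCat_of_isSlimGroup (isSlimGroup_gal_ofPlace F₂ p₂ v₂ hv₂)) Ψ Θ Θ' h h'⟩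

end OfPlace

end GoodLocalFrobenioid

end Literature.IUT.HodgeTheaters

end
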